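import Literature.Topology.FourManifolds.CylinderCobordism
import Literature.Topology.FourManifolds.HomotopySpheresBP
import Literature.Topology.FourManifolds.BordismProofs
import Literature.AlgebraicTopology.SingularHomology.SingularChains
import Mathlib.AlgebraicTopology.FundamentalGroupoid.SimplyConnected
import HarnessLib

/-!
# The cylinder `M × [0, 1]` as a null-cobordism of `M ⊔ M`, and the cylinder with a top point removed

Topic `Literature/Topology/FourManifolds`; first file of the merging-cobordism step (B2) in the
cone of the named fact `Literature.Topology.FourManifolds.isHCobordant_of_equivalent_intersectionForm`
(**Wall 1964, Thm. 2**; C. T. C. Wall, *On simply-connected 4-manifolds*, J. London Math. Soc.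
39 (1964) 141–149; `HCobordismDonaldson.lean`, `HCobordismWallAssembly.lean`). The remaining
tree-provable input `hmerge` of `isHCobordant_of_equivalent_intersectionForm_of_constructions` is
the cobordism `W₀ = (M₁ × I) ♮ (M₂ × I)` from `M₁ # M₂` to `M₁ ⊔ M₂` with its second homology
(Kervaire–Milnor 1963, Lemma 2.2; Kirby 1989, Ch. VIII: "`M₁ ⊔ M₂` is bordant to `M₁ # M₂` through
`(M₁ ⊔ M₂) × I ∪` 1-handle"). In the tree's construction (`BordismMerging.lean`) the two pieces
of that boundary connected sum are the cylinders `Mᵢ × [0, 1]` with ONE BOUNDARY POINT OF THE TOP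
COPY REMOVED, and the whole computation of `H₂(W₀)` rests on the elementary homotopy theory of
such a punctured cylinder, recorded here on the explicit model `Cylinder.carrier M ⊆ M × ℝ` of
`CylinderCobordism.lean`:

* `cylinderNullCobordism n M` — **the cylinder as a null-cobordism of the double `M ⊔ M`**
  (`NullCobordism n (M ⊕ M)`: total space `Cylinder.carrier M`, boundary inclusion
  `Sum.elim (x ↦ (x, 0)) (x ↦ (x, 1))`), the explicit form of the tree's
  `isCobordant_sum_self_of_isEmpty` (Milnor 1965, §1; Thom 1954, IV §1, `V + V ≃ 0`).
* `Cylinder.complTopHomotopyEquiv x₀` — **removing a point of the top copy does not change the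
  homotopy type**: the bottom slice `x ↦ (x, 0)` is a homotopy equivalence
  `M ≃ₕ (M × [0, 1]) ∖ {(x₀, 1)}` (inverse the projection; the vertical homotopy
  `(s, (x, t)) ↦ (x, s t)` avoids `(x₀, 1)`), whence the punctured cylinder is simply connected
  when `M` is (`Cylinder.simplyConnectedSpace_complTop`) and the bottom slice induces
  isomorphisms on homology (`Cylinder.isIso_map_bottomToComplTop`).
* `Cylinder.bottomRestrict_homotopic_topRestrict` — **off `x₀`, the bottom and the top slices are
  homotopic inside the punctured cylinder** (`(s, x) ↦ (x, s)`), so they agree on homology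
  (`Cylinder.map_bottomRestrict_eq_map_topRestrict`): a cycle of `M ∖ {x₀}` pushed to the top
  copy is homologous, in the punctured cylinder, to the same cycle in the bottom copy — the
  mechanism behind "`H₂(Mᵢ) → H₂(W₀)` through the bottom copy equals the summand inclusion
  through `M₁ # M₂ ⊆ ∂W₀`".

Everything is proved; the definitions are explicit constructions (no named facts).

## References

* J. Milnor, *Lectures on the h-cobordism theorem*, Princeton (1965), §1. [MilnorHCobordism1965]
* M. Kervaire, J. Milnor, *Groups of homotopy spheres I*, Ann. of Math. 77 (1963), §2 Lemma 2.2.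
  [KervaireMilnorAnnals1963]
* A. Hatcher, *Algebraic Topology*, CUP (2002), Ch. 0 (homotopy equivalences), Cor. 2.11.
  [HatcherAT2002]
-/

open scoped Manifold ContDiff Topology unitInterval ContinuousMap
open Set Function
open Literature.AlgebraicTopology.SingularHomology

noncomputable section

universe u

namespace Literature.Topology.FourManifolds

/-- Local notation: `𝔼 n` is the model Euclidean space `EuclideanSpace ℝ (Fin n)`. -/
local notation "𝔼 " n:arg => EuclideanSpace ℝ (Fin n)

/-! ### The cylinder as a null-cobordism of the double -/

section Double

variable (n : ℕ) (M : Type u) [TopologicalSpace M] [T2Space M] [SecondCountableTopology M]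
  [ChartedSpace (𝔼 n) M] [IsManifold (𝓡 n) ∞ M] [CompactSpace M]

/-- **The cylinder `M × [0, 1]` as a null-cobordism of the double `M ⊔ M`**: total space
`Cylinder.carrier M ⊆ M × ℝ` (`CylinderCobordism.lean`), boundary inclusion the bottom slice on
the first summand and the top slice on the second (Milnor 1965, §1; Thom 1954, Ch. IV §1,
"`V + V ≃ 0`"; the explicit form of the tree's `isCobordant_sum_self_of_isEmpty`).
[cite: MilnorHCobordism1965, §1] -/
def cylinderNullCobordism : NullCobordism n (M ⊕ M) where
  W := (cylinderCobordism n M).W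
  incl := Sum.elim (cylinderCobordism n M).inl (cylinderCobordism n M).inr
  isSmoothEmbedding_incl :=
    haveI : T2Space (cylinderCobordism n M).W := (cylinderCobordism n M).t2Space
    (cylinderCobordism n M).isSmoothEmbedding_inl.sumElim (cylinderCobordism n M).isSmoothEmbedding_inr
      (cylinderCobordism n M).disjoint_range
  range_incl := by
    rw [Set.Sum.elim_range]
    exact (cylinderCobordism n M).range_inl_union_range_inr

/-- The total space of `cylinderNullCobordism` is the cylinder `Cylinder.carrier M`. [folklore] -/
@[simp] theorem cylinderNullCobordism_W :
    (cylinderNullCobordism n M).W = ↥(Cylinder.carrier M) := rfl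

/-- On the first summand the boundary inclusion is the bottom slice `x ↦ (x, 0)` (the incoming
end of `cylinderCobordism`). [folklore] -/
@[simp] theorem cylinderNullCobordism_incl_inl (x : M) :
    (cylinderNullCobordism n M).incl (Sum.inl x) = Cylinder.sliceEnd M 0 ⟨le_rfl, zero_le_one⟩ x :=
  rfl

/-- On the second summand the boundary inclusion is the top slice `x ↦ (x, 1)` (the outgoing end
of `cylinderCobordism`). [folklore] -/
@[simp] theorem cylinderNullCobordism_incl_inr (x : M) :
    (cylinderNullCobordism n M).incl (Sum.inr x) = Cylinder.sliceEnd M 1 ⟨zero_le_one, le_rfl⟩ x :=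
  rfl

end Double

/-! ### The cylinder with a point of the top copy removed -/

namespace Cylinder

variable {M : Type u} [TopologicalSpace M]

/-- The point `(x₀, 1)` of the top copy. [folklore] -/
abbrev topPt (x₀ : M) : ↥(carrier M) := sliceEnd M 1 ⟨zero_le_one, le_rfl⟩ x₀

/-- The cylinder with the top point `(x₀, 1)` removed. [folklore] -/
abbrev complTop (x₀ : M) : Set ↥(carrier M) := {topPt x₀}ᶜ

omit [TopologicalSpace M] in
/-- A point of the cylinder other than `(x₀, 1)`: either its `M`-coordinate is not `x₀` or its
height is not `1`. [folklore] -/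
theorem mem_complTop_iff {x₀ : M} {p : ↥(carrier M)} :
    p ∈ complTop x₀ ↔ ¬ (p.1.1 = x₀ ∧ p.1.2 = 1) := by
  rw [mem_compl_iff, mem_singleton_iff, not_iff_not]
  constructor
  · rintro rfl
    exact ⟨rfl, rfl⟩
  · rintro ⟨h1, h2⟩
    exact Subtype.ext (Prod.ext h1 h2)

omit [TopologicalSpace M] in
/-- The bottom slice misses `(x₀, 1)`. [folklore] -/
theorem sliceEnd_zero_mem_complTop (x₀ x : M) :
    sliceEnd M 0 ⟨le_rfl, zero_le_one⟩ x ∈ complTop x₀ := by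
  rw [mem_complTop_iff]
  rintro ⟨-, h⟩
  exact zero_ne_one ((coe_sliceEnd (M := M) 0 ⟨le_rfl, zero_le_one⟩ x ▸ h :))

/-- The bottom slice into the punctured cylinder, `x ↦ (x, 0)`. [folklore] -/
def bottomToComplTop (x₀ : M) : C(M, ↥(complTop x₀)) :=
  ⟨fun x => ⟨sliceEnd M 0 ⟨le_rfl, zero_le_one⟩ x, sliceEnd_zero_mem_complTop x₀ x⟩,
    (continuous_sliceEnd 0 _).subtype_mk _⟩

/-- The projection of the punctured cylinder to `M`. [folklore] -/
def projComplTop (x₀ : M) : C(↥(complTop x₀), M) :=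
  proj.comp ⟨Subtype.val, continuous_subtype_val⟩

/-- `proj ∘ bottom = id` on the nose. [folklore] -/
theorem projComplTop_comp_bottomToComplTop (x₀ : M) :
    (projComplTop x₀).comp (bottomToComplTop x₀) = ContinuousMap.id M := by
  ext x; rfl

/-- The product `s · t` of two points of `[0, 1]` lies in `[0, 1]`. [folklore] -/
theorem mul_mem_Icc {s t : ℝ} (hs : s ∈ Icc (0 : ℝ) 1) (ht : t ∈ Icc (0 : ℝ) 1) :
    s * t ∈ Icc (0 : ℝ) 1 :=
  ⟨mul_nonneg hs.1 ht.1, mul_le_one₀ hs.2 ht.1 ht.2⟩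

/-- **The vertical homotopy `(s, (x, t)) ↦ (x, s t)`** from `bottom ∘ proj` to the identity of the
punctured cylinder: it stays off `(x₀, 1)` because `s t = 1` forces `s = t = 1`. [folklore] -/
def complTopHomotopy (x₀ : M) :
    ContinuousMap.Homotopy ((bottomToComplTop x₀).comp (projComplTop x₀))
      (ContinuousMap.id ↥(complTop x₀)) where
  toFun sp := ⟨⟨((sp.2 : ↥(carrier M)).1.1, (sp.1 : ℝ) * (sp.2 : ↥(carrier M)).1.2),
      mem_carrier_iff.2 (mul_mem_Icc ⟨sp.1.2.1, sp.1.2.2⟩ (mem_carrier_iff.1 (sp.2 : ↥(carrier M)).2))⟩,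
    by
      rw [mem_complTop_iff]
      rintro ⟨hx, hst⟩
      have ht := (mem_carrier_iff.1 (sp.2 : ↥(carrier M)).2)
      have hs1 : (sp.1 : ℝ) ≤ 1 := sp.1.2.2
      have ht1 : ((sp.2 : ↥(carrier M)) : M × ℝ).2 ≤ 1 := ht.2
      have hs0 : 0 ≤ (sp.1 : ℝ) := sp.1.2.1
      have ht0 : 0 ≤ ((sp.2 : ↥(carrier M)) : M × ℝ).2 := ht.1
      have hteq : ((sp.2 : ↥(carrier M)) : M × ℝ).2 = 1 := by
        change (sp.1 : ℝ) * ((sp.2 : ↥(carrier M)) : M × ℝ).2 = 1 at hst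
        nlinarith
      exact (mem_complTop_iff.1 (sp.2).2) ⟨hx, hteq⟩⟩
  continuous_toFun := by
    refine Continuous.subtype_mk (Continuous.subtype_mk (Continuous.prodMk ?_ ?_) _) _
    · exact continuous_fst.comp (continuous_subtype_val.comp
        (continuous_subtype_val.comp continuous_snd))
    · exact (continuous_subtype_val.comp continuous_fst).mul
        (continuous_snd.comp (continuous_subtype_val.comp
          (continuous_subtype_val.comp continuous_snd)))
  map_zero_left p := by
    apply Subtype.ext; apply Subtype.ext
    exact Prod.ext rfl (zero_mul _)
  map_one_left p := by
    apply Subtype.ext; apply Subtype.ext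
    exact Prod.ext rfl (one_mul _)

/-- **Removing a point of the top copy does not change the homotopy type of the cylinder**: the
bottom slice is a homotopy equivalence `M ≃ₕ (M × [0, 1]) ∖ {(x₀, 1)}` (homotopy inverse the
projection; Hatcher 2002, Ch. 0). [cite: HatcherAT2002, Ch. 0 (homotopy equivalence)] -/
def complTopHomotopyEquiv (x₀ : M) : M ≃ₕ ↥(complTop x₀) where
  toFun := bottomToComplTop x₀
  invFun := projComplTop x₀
  left_inv := by rw [projComplTop_comp_bottomToComplTop]
  right_inv := ⟨complTopHomotopy x₀⟩

/-- **The punctured cylinder `(M × [0, 1]) ∖ {(x₀, 1)}` is simply connected when `M` is**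
(homotopy invariance, Mathlib `ContinuousMap.HomotopyEquiv.simplyConnectedSpace`).
[cite: HatcherAT2002, Prop. 1.18] -/
theorem simplyConnectedSpace_complTop [SimplyConnectedSpace M] (x₀ : M) :
    SimplyConnectedSpace ↥(complTop x₀) :=
  (complTopHomotopyEquiv x₀).symm.simplyConnectedSpace

/-- **The bottom slice induces isomorphisms `Hₖ(M) ≅ Hₖ((M × [0, 1]) ∖ {(x₀, 1)})`**
(Hatcher 2002, Cor. 2.11). [cite: HatcherAT2002, Cor. 2.11] -/
theorem isIso_map_bottomToComplTop (R : Type u) [CommRing R] (x₀ : M) (k : ℕ) :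
    CategoryTheory.IsIso (singularHomology.map R R (bottomToComplTop x₀) k) :=
  (singularHomology.isoOfHomotopyEquiv R R (complTopHomotopyEquiv x₀) k).isIso_hom

/-! ### Off `x₀`, the bottom and the top slices are homotopic in the punctured cylinder -/

omit [TopologicalSpace M] in
/-- A slice at height `c` of a point other than `x₀` misses `(x₀, 1)`. [folklore] -/
theorem sliceEnd_mem_complTop_of_ne {x₀ : M} (c : ℝ) (hc : c ∈ Icc (0 : ℝ) 1) {x : M}
    (hx : x ≠ x₀) : sliceEnd M c hc x ∈ complTop x₀ := by
  rw [mem_complTop_iff]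
  rintro ⟨h, -⟩
  exact hx h

/-- The bottom slice restricted to `M ∖ {x₀}`, into the punctured cylinder. [folklore] -/
def bottomRestrict (x₀ : M) : C(↥({x₀}ᶜ : Set M), ↥(complTop x₀)) :=
  ⟨fun x => ⟨sliceEnd M 0 ⟨le_rfl, zero_le_one⟩ x, sliceEnd_mem_complTop_of_ne 0 _ x.2⟩,
    ((continuous_sliceEnd 0 _).comp continuous_subtype_val).subtype_mk _⟩

/-- The top slice restricted to `M ∖ {x₀}`, into the punctured cylinder. [folklore] -/
def topRestrict (x₀ : M) : C(↥({x₀}ᶜ : Set M), ↥(complTop x₀)) :=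
  ⟨fun x => ⟨sliceEnd M 1 ⟨zero_le_one, le_rfl⟩ x, sliceEnd_mem_complTop_of_ne 1 _ x.2⟩,
    ((continuous_sliceEnd 1 _).comp continuous_subtype_val).subtype_mk _⟩

/-- The restricted bottom slice is the bottom slice composed with the inclusion of `M ∖ {x₀}`.
[folklore] -/
theorem bottomRestrict_eq_comp (x₀ : M) :
    bottomRestrict x₀ = (bottomToComplTop x₀).comp ⟨Subtype.val, continuous_subtype_val⟩ := rfl

/-- **Off `x₀`, the bottom and the top slices are homotopic inside the punctured cylinder**, by
the vertical homotopy `(s, x) ↦ (x, s)`, which misses `(x₀, 1)` because `x ≠ x₀`. [folklore] -/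
theorem bottomRestrict_homotopic_topRestrict (x₀ : M) :
    (bottomRestrict x₀).Homotopic (topRestrict x₀) :=
  ⟨{ toFun := fun sx => ⟨sliceEnd M sx.1 ⟨sx.1.2.1, sx.1.2.2⟩ sx.2, sliceEnd_mem_complTop_of_ne _ _ sx.2.2⟩
     continuous_toFun := by
       refine Continuous.subtype_mk (Continuous.subtype_mk (Continuous.prodMk ?_ ?_) _) _
       · exact continuous_subtype_val.comp continuous_snd
       · exact continuous_subtype_val.comp continuous_fst
     map_zero_left := fun x => rfl
     map_one_left := fun x => rfl }⟩

/-- **Hence the bottom and the top copies of a class of `M ∖ {x₀}` agree in the homology of the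
punctured cylinder** (homotopy invariance, Hatcher 2002, Thm. 2.10).
[cite: HatcherAT2002, Thm. 2.10] -/
theorem map_bottomRestrict_eq_map_topRestrict (R : Type u) [CommRing R] (x₀ : M) (k : ℕ) :
    singularHomology.map R R (bottomRestrict x₀) k = singularHomology.map R R (topRestrict x₀) k :=
  singularHomology.map_eq_of_homotopic R R (bottomRestrict_homotopic_topRestrict x₀) k

end Cylinder

end Literature.Topology.FourManifolds

end
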